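import Summits.ResolutionOfSingularities.ResolutionOfSingularities.Theorems.EquisingularLiftEquisingularLiftNatSubmaxLinNShape
import Summits.ResolutionOfSingularities.ResolutionOfSingularities.Theorems.EquisingularLiftEquisingularLiftNatResidualDegreeThree
import HarnessLib

/-!
# The honest residual of the route decl `EquisingularLiftNat` (stmt-ResolutionOfSingularities-20038) RE-CUT BY NAME IN EVERY DIMENSION:
# hypersurfaces with a codimension-2 linear subspace of submaximal multiplicity (in any linear coordinates) are discharged in every characteristic

[OURS · leafhand-res-equisingularlift-7 g0, 2026-08-31; cell `pub/decomp-res`; item stmt-…-20038] AI-produced, weaker than expert review; NOT a statement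
of any manuscript; nothing here proves resolution of singularities.  DEF-FREE; no `sorry`; standard axioms; ZERO named hypotheses; pure reduction over
✓ `QuadricELNat.equisingularLiftNat_of_forall_elnatO_primeForms_three_le` (p820141), ✓ `SubmaxLinN.exists_shape_of_mem_powN` and
✓ `SubmaxLinN.elNatAt_of_linSubst_submaxLinN` (this generation).

* ★ `equisingularLiftNat_of_forall_elnatO_off_submaxLinN` — `Theses.EquisingularLift.EquisingularLiftNat` holds BY NAME as soon as `ELNatConclusionO`
  is known for the non-regular integral `H ⊆ ℙⁿ_k̄` (`n ≥ 3`) cut out by prime forms `F` of degree `e ≥ 3` such that for NO invertible linear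
  substitution `σ_{τ'}` and no `d` with `σ_{τ'} F` of degree `d + 2` one has `σ_{τ'} F ∈ (x_{n−1}, x_n)^{d+1}` — i.e. `V₊(F)` has no codimension-2
  linear subspace of multiplicity `e − 1`.  (The `n = 3` version is `SubmaxLine.equisingularLiftNat_of_forall_elnatO_off_submaxLine`, p822681.)

Honest reading: closes no registered stub; for `n ≥ 4` the residual still contains the summit.
-/

set_option linter.dupNamespace false -- mandated namespace `Summit.<Summit>.<Problem>` of this single-conjunct summit

noncomputable section

open CategoryTheory CategoryTheory.Limits AlgebraicGeometry TopologicalSpace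
open MvPolynomial
open Literature.AlgebraicGeometry.Resolution
open Literature.AlgebraicGeometry.Motives Literature.AlgebraicGeometry.Motives.SmoothHypersurface

namespace Summit.ResolutionOfSingularities.ResolutionOfSingularities.Cruxes.EquisingularLiftNat.Sections

namespace SubmaxLinN

/-- ★ **`Theses.EquisingularLift.EquisingularLiftNat` (stmt-…-20038) from `ELNatConclusionO` OFF THE HYPERSURFACES WITH A CODIMENSION-2 LINEAR
SUBSPACE OF SUBMAXIMAL MULTIPLICITY, every dimension**: the hypothesis of ✓ `QuadricELNat.equisingularLiftNat_of_forall_elnatO_primeForms_three_le`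
weakened by the clause «for all mutually inverse linear substitutions `τ, τ'` and all `d` with `σ_{τ'} F` homogeneous of degree `d + 2`:
`σ_{τ'} F ∉ (x_{n−1}, x_n)^{d+1}`» — those `H` being settled by ✓ `exists_shape_of_mem_powN` + ✓ `elNatAt_of_linSubst_submaxLinN` in every
characteristic. [OURS · lh7 · DEF-FREE · pure reduction] [cite: Hartshorne1977, I Ex. 5.12] -/
theorem equisingularLiftNat_of_forall_elnatO_off_submaxLinN
    (h : ∀ p : ℕ, p.Prime → ∀ (k : Type) [Field k] [CharP k p] [IsAlgClosed k] (n : ℕ) (H : Scheme.{0})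
      (ι : H ⟶ (Literature.AlgebraicGeometry.Motives.projectiveSpace n k).left), IsClosedImmersion ι → IsIntegral H →
      (∀ y : (Literature.AlgebraicGeometry.Motives.projectiveSpace n k).left,
        ∃ U : (Literature.AlgebraicGeometry.Motives.projectiveSpace n k).left.affineOpens,
          y ∈ (U : (Literature.AlgebraicGeometry.Motives.projectiveSpace n k).left.Opens) ∧ (ι.ker.ideal U).IsPrincipal) →
      3 ≤ n → ¬ Scheme.IsRegular H → ∀ (e : ℕ) (F : MvPolynomial (Fin (n + 1)) k), 3 ≤ e → F.IsHomogeneous e → Prime F →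
      (letI := MvPolynomial.gradedAlgebra (σ := Fin (n + 1)) (R := k)
       Set.range ι = {x : Proj (homogeneousSubmodule (Fin (n + 1)) k) | F ∈ x.asHomogeneousIdeal}) →
      (∀ (τ τ' : Fin (n + 1) → MvPolynomial (Fin (n + 1)) k) (d : ℕ),
        (∀ i, (τ i).IsHomogeneous 1) → (∀ i, (τ' i).IsHomogeneous 1) → (∀ i, aeval τ (τ' i) = X i) → (∀ i, aeval τ' (τ i) = X i) →
        (aeval τ' F).IsHomogeneous (d + 2) →
        aeval τ' F ∉ (Ideal.span {(X ⟨n - 1, by omega⟩ : MvPolynomial (Fin (n + 1)) k), X ⟨n, by omega⟩}) ^ (d + 1)) →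
      ELNatConclusionO k n H ι) :
    Summit.ResolutionOfSingularities.ResolutionOfSingularities.Theses.EquisingularLift.EquisingularLiftNat := by
  refine QuadricELNat.equisingularLiftNat_of_forall_elnatO_primeForms_three_le ?_
  intro p hp k _ _ _ n H ι hι hH hloc hn hreg e F he hF hprime hrange
  obtain ⟨r, rfl⟩ : ∃ r, n = r + 1 + 1 := ⟨n - 2, by omega⟩
  by_cases hex : ∃ (τ τ' : Fin (r + 1 + 1 + 1) → MvPolynomial (Fin (r + 1 + 1 + 1)) k) (d : ℕ),
      (∀ i, (τ i).IsHomogeneous 1) ∧ (∀ i, (τ' i).IsHomogeneous 1) ∧ (∀ i, aeval τ (τ' i) = X i) ∧ (∀ i, aeval τ' (τ i) = X i) ∧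
      (aeval τ' F).IsHomogeneous (d + 2) ∧
      aeval τ' F ∈ (Ideal.span {(X (⟨r + 1, by omega⟩ : Fin (r + 1 + 1 + 1)) : MvPolynomial (Fin (r + 1 + 1 + 1)) k),
        X (⟨r + 1 + 1, by omega⟩ : Fin (r + 1 + 1 + 1))}) ^ (d + 1)
  · obtain ⟨τ, τ', d, hτ, hτ', hinv, hinv', hFd, hmem⟩ := hex
    haveI := hι
    obtain ⟨A, C, hA, hC, hFeq⟩ := exists_shape_of_mem_powN k (aeval τ' F) hFd hmem
    exact RouteCurrency.elnatO_of_elNatAt p hp k (r + 1 + 1) H ι hι hH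
      (elNatAt_of_linSubst_submaxLinN p hp τ τ' hτ hτ' hinv hinv' A C hA hC ι F hprime hFeq hrange)
  · push Not at hex
    refine h p hp k (r + 1 + 1) H ι hι hH hloc hn hreg e F he hF hprime hrange fun τ τ' d hτ hτ' hinv hinv' hFd hmem => ?_
    refine hex τ τ' d hτ hτ' hinv hinv' hFd ?_
    have h1 : (⟨r + 1 + 1 - 1, by omega⟩ : Fin (r + 1 + 1 + 1)) = ⟨r + 1, by omega⟩ := Fin.ext (by simp)
    rw [h1] at hmem
    exact hmem

end SubmaxLinN

end Summit.ResolutionOfSingularities.ResolutionOfSingularities.Cruxes.EquisingularLiftNat.Sections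

end
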